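import Summits.BirchSwinnertonDyer.BirchSwinnertonDyer.Theorems.KatoDescentPotSupersingularKatoSelmerSharpBoundKato
import Summits.BirchSwinnertonDyer.BirchSwinnertonDyer.Theorems.KatoDescentPotSupersingularKatoSelmerFinite
import Summits.BirchSwinnertonDyer.BirchSwinnertonDyer.Theorems.KatoDescentPotSupersingularKatoFiniteLevelStrictBounds
import Summits.BirchSwinnertonDyer.Rank1Residual.X11b.PropagatedLocalConditions
import HarnessLib

/-!
# Brick (a) of crux M's level-0 ledger, TURNKEY: for every level `k ≥ k₀` the sharp S-side inequality
# `#S(E[p^∞]) · [B_k : B_k ∩ 𝓚_k^⊥] ≤ #Sel_str^{ur}(E[p^∞]) · p^k` holds for Kato's `A = H¹(ℤ[1/p], T_pE)`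
# — the exponent hypotheses `hm`, `hN`, `hj` of part 37 discharged from `Sel_{p^∞}(E/ℚ)` finite
# (route `KatoDescentPotSupersingular` / `…Tame…`, crux M = stmt-BirchSwinnertonDyer-19196; route-free helper)

Seat `bsd-potss-rkm` g19 (prover; cell `bsd-potss`), item stmt-BirchSwinnertonDyer-19196 (`--supports … --as helper`; closes
nothing).  HONEST FRAMING: BSD is not proved by any of this; nothing is booked; theorems only (no definition, no named fact).

## What

Part 37 (`…KatoSelmerSharpBoundKato.natCard_kato_mul_relIndex_le`) proves brick (a) at level `p^{m+e}` under three exponent hypotheses: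
`p^m · S = 0` (hm), the divisibility bound (hN) off `p` at `(m, e)`, and `p^j · E(ℚ_p)[p^∞] = 0` (hj).  All three hold for suitable exponents:
`hm` by part 38 (`exists_pow_nsmul_kato_eq_zero_rat`: `S` is finite when `Sel_{p^∞}(E/ℚ)` is), `hN` for every `e ≥ e₁` by g17's
`exists_forall_hN`, `hj` by part 38 (`exists_pow_nsmul_eq_zero_of_primary_localPoints`: the torsion of `E(ℚ_p)` is finite).  Hence:

* **`exists_forall_natCard_kato_mul_relIndex_le`** — `W/ℚ` elliptic, `p` odd, `Sel_{p^∞}(E/ℚ)` finite (rank `0`, `Ш[p^∞]` finite), `T ∋ v_p`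
  a finite set of places off which `W` has good reduction, `𝓤∞`/`𝓢∞` Kato's relaxed/strict structures on `E[p^∞]`: **there are `j` and `k₀` such
  that for EVERY `k ≥ k₀`, every Poitou–Tate family `inv` at level `p^j p^k` (perfect at the finite places, `∑_v ⟨·,·⟩_v = 0` on global classes)
  and every level-`p^j p^k` Weil datum `ε`:**
  `#S · [B_k : B_k ⊓ 𝓚_k^⊥] ≤ #Sel_str^{ur} · p^k`, `B_k = loc_p (desc^♭)_* ι′_* red_{p^k}(H¹(ℤ[1/p], T_pE))`.
  The remaining inputs (`inv`, `ε`) EXIST by the tree's Poitou–Tate / Weil-pairing theorems at every level; they are kept as data because the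
  subgroup `B_k` is expressed through them.

This is the form in which brick (b) (Kato 14.18, `HasLocPKummerLog`: a lower bound for `[B_k : B_k ⊓ 𝓚_k^⊥]` from the zeta element) and the
Iwasawa side ((vi), through the KATO-H2 socket of parts 25–26) consume brick (a) in crux M's level-0 ledger (memo `HOME/rkm/FINDING-19196-rkm-g18.md`).

References: K. Kato, Astérisque 295 (2004), §14.8, Prop. 14.16 and its proof (pp. 244–245) [Kato2004Asterisque]; J. S. Milne, *ADT* I Cor. 2.3,
Thm. 2.6, Lemma 3.3, Thm. 4.10 (b) [MilneADT2006]; R. Greenberg, LNM 1716 §3 Lemma 3.3, §5 Prop. 5.8 [GreenbergLNM1716].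
-/

-- the summit and its single problem are both named `BirchSwinnertonDyer` (registry layout D-0017)
set_option linter.dupNamespace false
set_option autoImplicit false

noncomputable section

open scoped Classical ContRepresentation NumberField
open CategoryTheory Function Field NumberField IsDedekindDomain WeierstrassCurve
open Literature.NumberTheory.EllipticCurves Literature.NumberTheory.GaloisRepresentations
  Literature.NumberTheory.GaloisRepresentations.DiscreteGaloisModule Literature.NumberTheory.GaloisCohomology
open Literature.NumberTheory.EllipticCurves.Kato2004 Literature.NumberTheory.EllipticCurves.Kato2004.EulerSystemValues
open Summit.BirchSwinnertonDyer.Rank1Residual.X11b.Levels Summit.BirchSwinnertonDyer.Rank1Residual.X11b.LocBridge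
  Summit.BirchSwinnertonDyer.Rank1Residual.X11b.LevelKummer Summit.BirchSwinnertonDyer.Rank1Residual.X11b.FiniteDuality
  Summit.BirchSwinnertonDyer.Rank1Residual.X11b.AcSelmer
open Summit.BirchSwinnertonDyer.Rank1Residual.GaloisImage
open Summit.BirchSwinnertonDyer.BirchSwinnertonDyer.Theorems.KummerTowerOrthogonal

namespace Summit.BirchSwinnertonDyer.BirchSwinnertonDyer.Theorems.KatoFiniteLevelCount

section Final

variable (W : WeierstrassCurve ℚ) [W.IsElliptic] (p : ℕ) [Fact p.Prime] [ContinuousSMul ℤ_[p] (W.tateModule p)]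
  (𝓤inf 𝓢inf : SelmerStructure (primaryGaloisModule W p))

/-- **Brick (a), turnkey: for all `k ≥ k₀`, `#S(E[p^∞]) · [B_k : B_k ⊓ 𝓚_k^⊥] ≤ #Sel_str^{ur}(E[p^∞]) · p^k`.**  Hypotheses: `p` odd; `T ∋ v_p` finite
with good reduction off `T`; `Sel_{p^∞}(E/ℚ)` finite; `𝓤∞` (`⊤` at `v_p`, unramified at `ℓ ≠ p`, `⊤` at `∞`) and `𝓢∞` (`0` at `v_p`, same
elsewhere) on `E[p^∞]`, so that `S = H¹_{𝓤∞} ⊓ selmerLocalKerPrimary W ℚ_p p` is Kato's group and `H¹_{𝓢∞} = Sel_str^{ur}`.  Conclusion: there are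
`j`, `k₀` such that for every `k ≥ k₀`, every Poitou–Tate family `inv` at level `p^j p^k` and every level-`p^j p^k` Weil datum `ε`, with
`B_k = loc_p (desc^♭)_* ι′_* red_{p^k}(H¹(ℤ[1/p],T_pE))` (`desc` the descended Weil pairing, `ι′` the level transport, `red` Kato's reduction)
and `𝓚_k` the level-`p^k` Kummer condition at `v_p`: `#S · [B_k : B_k ⊓ 𝓚_k^⊥] ≤ #Sel_str^{ur} · p^k`.  Part 37 with `hm`, `hj` from part 38 and
(hN) from g17 `exists_forall_hN`. [cite: Kato2004Asterisque, §14.8 (p. 238), Prop. 14.16 and its proof (pp. 244–245)]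
[cite: MilneADT2006, Ch. I, Cor. 2.3, Thm. 2.6, Lemma 3.3, Thm. 4.10 (b)] -/
theorem exists_forall_natCard_kato_mul_relIndex_le (hodd : p ≠ 2) (T : Finset (HeightOneSpectrum (𝓞 ℚ)))
    (hpT : primePlace p ∈ T) (hT : ∀ v : HeightOneSpectrum (𝓞 ℚ), v ∉ T → W.HasGoodReductionAt v)
    [Finite (W.selmerGroupPInfty p)]
    (hUp : 𝓤inf (Sum.inr (primePlace p)) = ⊤)
    (hUur : ∀ v : HeightOneSpectrum (𝓞 ℚ), v ≠ primePlace p →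
      𝓤inf (Sum.inr v) = unramifiedSubgroup (GaloisRep.toLocal v (primaryGaloisModule W p)) 1)
    (hUinl : ∀ w : InfinitePlace ℚ, 𝓤inf (Sum.inl w) = ⊤)
    (hSp : 𝓢inf (Sum.inr (primePlace p)) = ⊥)
    (hSur : ∀ v : HeightOneSpectrum (𝓞 ℚ), v ≠ primePlace p →
      𝓢inf (Sum.inr v) = unramifiedSubgroup (GaloisRep.toLocal v (primaryGaloisModule W p)) 1)
    (hSinl : ∀ w : InfinitePlace ℚ, 𝓢inf (Sum.inl w) = ⊤) :
    ∃ j k₀ : ℕ, ∀ k : ℕ, k₀ ≤ k →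
      haveI := neZero_pow p j; haveI := neZero_pow p k
      haveI : Finite (geomTorsion W ((p ^ k : ℕ) : ℤ)) := finite_geomTorsion_pow W p k
      ∀ (inv : LocalInvariants ℚ (p ^ j * p ^ k)), inv.SumLocalTermEqZero → inv.IsPerfect →
      ∀ (ε : geomTorsion W ((p ^ j * p ^ k : ℕ) : ℤ) → geomTorsion W ((p ^ j * p ^ k : ℕ) : ℤ) → AlgebraicClosure ℚ)
        (hμ : ∀ S T, ε S T ^ (p ^ j * p ^ k) = 1)
        (hadd₁ : ∀ S₁ S₂ T, ε (S₁ + S₂) T = ε S₁ T * ε S₂ T)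
        (hadd₂ : ∀ S T₁ T₂, ε S (T₁ + T₂) = ε S T₁ * ε S T₂)
        (hgal : ∀ (σ : absoluteGaloisGroup ℚ) (S T : geomTorsion W ((p ^ j * p ^ k : ℕ) : ℤ)), σ • ε S T = ε (σ • S) (σ • T)),
      Nat.card ↥(𝓤inf.selmerGroup ⊓ selmerLocalKerPrimary W ((primePlace p).adicCompletion ℚ) p) *
          ((((integralH1 (tateRep W p) p ⊤).toAddSubgroup.map
                (((galoisCohomology.map (W.torsionInclusion (intPow_dvd_natCast_pow p k)) 1).comp
                    (ofTopSubgroup (W.torsionGaloisModule ((p : ℤ) ^ k)).toTopRep 1).hom.toLinearMap.toAddMonoidHom).comp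
                  (reduceH1Pk W p k ⊤))).map
                (galoisCohomology.map (DiscreteGaloisModule.pairingDualIntertwining
                  (ρ₁ := W.torsionGaloisModule ((p ^ k : ℕ) : ℤ)) (ρ₂ := W.torsionGaloisModule ((p ^ k : ℕ) : ℤ))
                  (B := descendHom W (p ^ j) (p ^ k) ε hμ hadd₁ hadd₂)
                  (descendHom_smul W (p ^ j) (p ^ k) ε hμ hadd₁ hadd₂ hgal)) 1)).map
              (galoisCohomology.localization ((W.torsionGaloisModule ((p ^ k : ℕ) : ℤ)).tateDual (p ^ j * p ^ k))
                (Sum.inr (primePlace p)) 1) ⊓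
            annRight (localTatePairingZMod (W.torsionGaloisModule ((p ^ k : ℕ) : ℤ)) (p ^ j * p ^ k)
              (Sum.inr (primePlace p)) (inv (Sum.inr (primePlace p))))
              (W.kummerSelmerStructure ((p ^ k : ℕ) : ℤ) (Sum.inr (primePlace p)))).relIndex
            ((((integralH1 (tateRep W p) p ⊤).toAddSubgroup.map
                (((galoisCohomology.map (W.torsionInclusion (intPow_dvd_natCast_pow p k)) 1).comp
                    (ofTopSubgroup (W.torsionGaloisModule ((p : ℤ) ^ k)).toTopRep 1).hom.toLinearMap.toAddMonoidHom).comp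
                  (reduceH1Pk W p k ⊤))).map
                (galoisCohomology.map (DiscreteGaloisModule.pairingDualIntertwining
                  (ρ₁ := W.torsionGaloisModule ((p ^ k : ℕ) : ℤ)) (ρ₂ := W.torsionGaloisModule ((p ^ k : ℕ) : ℤ))
                  (B := descendHom W (p ^ j) (p ^ k) ε hμ hadd₁ hadd₂)
                  (descendHom_smul W (p ^ j) (p ^ k) ε hμ hadd₁ hadd₂ hgal)) 1)).map
              (galoisCohomology.localization ((W.torsionGaloisModule ((p ^ k : ℕ) : ℤ)).tateDual (p ^ j * p ^ k))
                (Sum.inr (primePlace p)) 1)) ≤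
        Nat.card 𝓢inf.selmerGroup * p ^ k := by
  -- exponents: `p^m · S = 0`, (hN) for `e ≥ e₁`, `p^j · E(ℚ_p)[p^∞] = 0`
  obtain ⟨m, -, hm⟩ := exists_pow_nsmul_kato_eq_zero_rat W p hodd T hpT hT 𝓤inf hUur
  obtain ⟨e₁, he₁⟩ := exists_forall_hN W p {primePlace p} T
    (fun v hv => ⟨natCast_not_mem_of_ne_primePlace p (fun h => hv (h ▸ hpT)), hT v hv⟩)
  obtain ⟨j, hj⟩ := exists_pow_nsmul_eq_zero_of_primary_localPoints W p (primePlace p)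
  refine ⟨j, m + e₁, fun k hk => ?_⟩
  obtain ⟨e, rfl⟩ := Nat.exists_eq_add_of_le ((Nat.le_add_right m e₁).trans hk)
  have he : e₁ ≤ e := Nat.le_of_add_le_add_left hk
  intro inv hsum hperf ε hμ hadd₁ hadd₂ hgal
  haveI : Finite (geomTorsion W ((p ^ (m + e) : ℕ) : ℤ)) := finite_geomTorsion_pow W p (m + e)
  exact natCard_kato_mul_relIndex_le W p m e j 𝓤inf 𝓢inf inv ε hμ hadd₁ hadd₂ hgal hodd hsum hperf hUp hUur hUinl hSp hSur hSinl hm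
    (fun v hv x hx => he₁ e he m v (fun h => hv (Finset.mem_singleton.1 h)) x hx) hj

end Final

end Summit.BirchSwinnertonDyer.BirchSwinnertonDyer.Theorems.KatoFiniteLevelCount

end
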